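import Summits.ResolutionOfSingularities.ResolutionOfSingularities.Theses.HilbertSamuelElimination

/-!
# `SigmaMaxModifications` (crux stmt-ResolutionOfSingularities-18506, route HilbertSamuelElimination):
# the SPLIT GLUE `LowDim → Corridor3 → DimGe4 → SigmaMaxModifications` (fact-free)

Crux-strategist decomposition (2026-08-17) of the route crux
`Summit.ResolutionOfSingularities.ResolutionOfSingularities.Theses.HilbertSamuelElimination.SigmaMaxModifications`
(CJS, LNM 2270, Def. 6.15 in modification form) into three sub-statements, BY THE DIMENSION OF `X`
and, in dimension `3`, by whether the Hilbert–Samuel locus `X_max` meets the closure of the other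
singularities (`closure (Sing X ∖ X_max)`, the "corridor" case):

* `LowDim`  — the crux body when `dim X ≤ 2`, or `dim X ≤ 3` and `X_max` is DISJOINT from
  `closure (Sing X ∖ X_max)` (KNOWN IN PRINT: curves by point blow-ups — landed `stub_curve`;
  surfaces by Cossart–Jannsen–Saito Thm. 6.28 with Thm. 3.10 (1) — landed conditionally on the
  named fact `CossartJannsenSaito2020_sigmaMaxElimination` as `stub_surface_of_sigmaMaxFact`;
  isolated threefolds by Cossart–Piltant 2019 Thm. 1.1 glued with the identity — landed
  conditionally on `CossartPiltant2019General` as `sigmaMaxModifications_dim_le_three_of_isolated`);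
* `Corridor3` — the crux body when `dim X = 3` and `X_max` MEETS `closure (Sing X ∖ X_max)`
  (OPEN: CJS Rem. 6.29; CP2019 §1 — no resolution by modifications cosupported in `X_max` is known
  in dimension `3`, and over a corridor point no such modification can be regular);
* `DimGe4` — the crux body when `dim X ≥ 4` (OPEN: nothing is known in positive characteristic).

This file proves the glue `SigmaMaxModifications_of_subs : LowDim → Corridor3 → DimGe4 →
SigmaMaxModifications` by the trichotomy `dim X ≤ 2 ∨ dim X = 3 ∨ dim X ≥ 4` and excluded middle on
the corridor condition — pure logic, no named fact. The three hypotheses are written INLINE over the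
route file's fact-free imports exactly as the sub-items are filed on the route (the Hilbert–Samuel
function `H^N_Y(y) = H^{(N − ψ)}(𝒪_{Y,y})` as the crux's `let H := …`, the Hilbert–Samuel locus as
`{x | Maximal (· ∈ Set.range (H X)) (H X x)}` = `Scheme.hsMaxLocus X N` by `rfl`, the singular locus as
`{x | IsRegularLocalRing (X.presheaf.stalk x)}ᶜ` = `(Scheme.regularLocus X)ᶜ` by `rfl`), so that this
module stays outside the import cone of the twelve unproved facts (route header, cone repair
2026-08-17). The same equivalence modulo the two printed theorems is the lead's landed
`sigmaMaxModifications_iff_open_cores` (p160700).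

## Sources
* V. Cossart, U. Jannsen, S. Saito, LNM 2270 (2020): Def. 6.15, Cor. 6.18, Thm. 6.28, Rem. 6.29.
  [CossartJannsenSaito2020]
* V. Cossart, O. Piltant, J. Algebra 529 (2019), Thm. 1.1 and §1. [CossartPiltant2019]
-/

set_option linter.dupNamespace false -- mandated namespace of this single-conjunct summit

noncomputable section

open CategoryTheory AlgebraicGeometry TopologicalSpace Topology
open Summit.ResolutionOfSingularities.ResolutionOfSingularities.Theses.HilbertSamuelElimination

namespace Summit.ResolutionOfSingularities.ResolutionOfSingularities.Theorems.SigmaMaxModifications.Split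

/-! ## Dimension bookkeeping in `WithBot ℕ∞` -/

/-- Dichotomy in `WithBot ℕ∞`: `D ≤ m` or `m + 1 ≤ D`. [folklore] -/
theorem dim_le_or_succ_le (D : WithBot ℕ∞) (m : ℕ) :
    D ≤ (m : WithBot ℕ∞) ∨ ((m + 1 : ℕ) : WithBot ℕ∞) ≤ D := by
  induction D using WithBot.recBotCoe with
  | bot => exact Or.inl bot_le
  | coe d =>
    induction d using ENat.recTopCoe with
    | top => exact Or.inr (by exact_mod_cast le_top)
    | coe d =>
      have cast : ∀ n : ℕ, ((n : ℕ∞) : WithBot ℕ∞) = (n : WithBot ℕ∞) := fun n => rfl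
      rw [cast]
      rcases Nat.lt_or_ge d (m + 1) with h | h
      · exact Or.inl (Nat.cast_le.mpr (by omega))
      · exact Or.inr (Nat.cast_le.mpr h)

/-- Trichotomy of a dimension in `WithBot ℕ∞`: `≤ 2`, or `= 3` (as `3 ≤ D ≤ 3`), or `≥ 4`.
[folklore] -/
theorem dim_trichotomy₃ (D : WithBot ℕ∞) :
    D ≤ ((2 : ℕ) : WithBot ℕ∞) ∨
      (((3 : ℕ) : WithBot ℕ∞) ≤ D ∧ D ≤ ((3 : ℕ) : WithBot ℕ∞)) ∨
      ((4 : ℕ) : WithBot ℕ∞) ≤ D := by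
  rcases dim_le_or_succ_le D 2 with h | h
  · exact Or.inl h
  · rcases dim_le_or_succ_le D 3 with h' | h'
    · exact Or.inr (Or.inl ⟨h, h'⟩)
    · exact Or.inr (Or.inr h')

/-! ## The glue -/

/-- **SPLIT GLUE** (crux-strategist decomposition of item stmt-ResolutionOfSingularities-18506):
the crux `SigmaMaxModifications` follows from its three dimension-graded pieces — `LowDim`
(`dim X ≤ 2`, or `dim X ≤ 3` with `X_max` disjoint from `closure (Sing X ∖ X_max)`; known in print:
CJS Thm. 6.28 + Thm. 3.10 (1) for surfaces, Cossart–Piltant 2019 Thm. 1.1 glued with the identity for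
isolated threefolds, point blow-ups for curves), `Corridor3` (`dim X = 3`, `X_max` meets
`closure (Sing X ∖ X_max)`; open) and `DimGe4` (`dim X ≥ 4`; open) — by the trichotomy on `dim X` and
excluded middle on the corridor condition. Pure logic over the inline Hilbert–Samuel function of the
route file; no named fact is used. [cite: CossartJannsenSaito2020, Def. 6.15, Rem. 6.29]
[cite: CossartPiltant2019, Thm. 1.1, §1] -/
theorem SigmaMaxModifications_of_subs :
    (∀ p : ℕ, p.Prime → ∀ (k : Type) [Field k] [CharP k p] (X : AlgebraicGeometry.Scheme.{0}) (f : X ⟶ AlgebraicGeometry.Spec (.of k)), AlgebraicGeometry.IsSeparated f → AlgebraicGeometry.LocallyOfFiniteType f → AlgebraicGeometry.QuasiCompact f → AlgebraicGeometry.IsReduced X → ¬ Literature.AlgebraicGeometry.Resolution.Scheme.IsRegular X → ∀ N : ℕ, topologicalKrullDim X ≤ (N : WithBot ℕ∞) → let H : (Y : AlgebraicGeometry.Scheme.{0}) → Y → ℕ → ℕ := fun Y y => Literature.RingTheory.HilbertSamuel.hilbertSamuelFun (Y.presheaf.stalk y) (N - Literature.RingTheory.HilbertSamuel.minimalPrimesCodim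 (Y.presheaf.stalk y)); (topologicalKrullDim X ≤ ((2 : ℕ) : WithBot ℕ∞) ∨ (topologicalKrullDim X ≤ ((3 : ℕ) : WithBot ℕ∞) ∧ Disjoint (closure ({x : X | IsRegularLocalRing (X.presheaf.stalk x)}ᶜ \ {x | Maximal (· ∈ Set.range (H X)) (H X x)})) {x | Maximal (· ∈ Set.range (H X)) (H X x)})) → ∃ (X' : AlgebraicGeometry.Scheme.{0}) (π : X' ⟶ X), AlgebraicGeometry.IsProper π ∧ AlgebraicGeometry.IsReduced X' ∧ topologicalKrullDim X' ≤ (N : WithBot ℕ∞) ∧ (∀ U : X.Opens, (U : Set X) ⊆ {x | Maximal (· ∈ Set.range (H X)) (H X x)}ᶜ → CategoryTheory.IsIso (π ∣_ U)) ∧ Dense ((fun x' => π.base x') ⁻¹' {x | Maximal (· ∈ Set.range (H X)) (H X x)}ᶜ) ∧ (∀ x' : X', H X' x' ≤ H X (π.base x')) ∧ ∀ ν : ℕ → ℕ, Maximal (· ∈ Set.range (H X)) ν → ν ∉ Set.range (H X')) →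
    (∀ p : ℕ, p.Prime → ∀ (k : Type) [Field k] [CharP k p] (X : AlgebraicGeometry.Scheme.{0}) (f : X ⟶ AlgebraicGeometry.Spec (.of k)), AlgebraicGeometry.IsSeparated f → AlgebraicGeometry.LocallyOfFiniteType f → AlgebraicGeometry.QuasiCompact f → AlgebraicGeometry.IsReduced X → ¬ Literature.AlgebraicGeometry.Resolution.Scheme.IsRegular X → ((3 : ℕ) : WithBot ℕ∞) ≤ topologicalKrullDim X → topologicalKrullDim X ≤ ((3 : ℕ) : WithBot ℕ∞) → ∀ N : ℕ, topologicalKrullDim X ≤ (N : WithBot ℕ∞) → let H : (Y : AlgebraicGeometry.Scheme.{0}) → Y → ℕ → ℕ := fun Y y => Literature.RingTheory.HilbertSamuel.hilbertSamuelFun (Y.presheaf.stalk y) (N - Literature.RingTheory.HilbertSamuel.minimalPrimesCodim (Y.presheaf.stalk y)); ¬ Disjoint (closure ({x : X | IsRegularLocalRing (X.presheaf.stalk x)}ᶜ \ {x | Maximal (· ∈ Set.range (H X)) (H X x)})) {x | Maximal (· ∈ Set.range (H X)) (H X x)} → ∃ (X' : AlgebraicGeometry.Scheme.{0}) (π : X'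 ⟶ X), AlgebraicGeometry.IsProper π ∧ AlgebraicGeometry.IsReduced X' ∧ topologicalKrullDim X' ≤ (N : WithBot ℕ∞) ∧ (∀ U : X.Opens, (U : Set X) ⊆ {x | Maximal (· ∈ Set.range (H X)) (H X x)}ᶜ → CategoryTheory.IsIso (π ∣_ U)) ∧ Dense ((fun x' => π.base x') ⁻¹' {x | Maximal (· ∈ Set.range (H X)) (H X x)}ᶜ) ∧ (∀ x' : X', H X' x' ≤ H X (π.base x')) ∧ ∀ ν : ℕ → ℕ, Maximal (· ∈ Set.range (H X)) ν → ν ∉ Set.range (H X')) →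
    (∀ p : ℕ, p.Prime → ∀ (k : Type) [Field k] [CharP k p] (X : AlgebraicGeometry.Scheme.{0}) (f : X ⟶ AlgebraicGeometry.Spec (.of k)), AlgebraicGeometry.IsSeparated f → AlgebraicGeometry.LocallyOfFiniteType f → AlgebraicGeometry.QuasiCompact f → AlgebraicGeometry.IsReduced X → ¬ Literature.AlgebraicGeometry.Resolution.Scheme.IsRegular X → ((4 : ℕ) : WithBot ℕ∞) ≤ topologicalKrullDim X → ∀ N : ℕ, topologicalKrullDim X ≤ (N : WithBot ℕ∞) → let H : (Y : AlgebraicGeometry.Scheme.{0}) → Y → ℕ → ℕ := fun Y y => Literature.RingTheory.HilbertSamuel.hilbertSamuelFun (Y.presheaf.stalk y) (N - Literature.RingTheory.HilbertSamuel.minimalPrimesCodim (Y.presheaf.stalk y)); ∃ (X' : AlgebraicGeometry.Scheme.{0}) (π : X' ⟶ X), AlgebraicGeometry.IsProper π ∧ AlgebraicGeometry.IsReduced X' ∧ topologicalKrullDim X' ≤ (N : WithBot ℕ∞) ∧ (∀ U : X.Opens, (U : Set X) ⊆ {x | Maximal (· ∈ Set.range (H X)) (H X x)}ᶜ → CategoryTheory.IsIso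 (π ∣_ U)) ∧ Dense ((fun x' => π.base x') ⁻¹' {x | Maximal (· ∈ Set.range (H X)) (H X x)}ᶜ) ∧ (∀ x' : X', H X' x' ≤ H X (π.base x')) ∧ ∀ ν : ℕ → ℕ, Maximal (· ∈ Set.range (H X)) ν → ν ∉ Set.range (H X')) →
    SigmaMaxModifications := by
  intro hlow hcor h4 p hp k _ _ X f hsep hft hqc hred hreg N hdim
  rcases dim_trichotomy₃ (topologicalKrullDim X) with h2 | ⟨h3, h3'⟩ | h4'
  · -- dimension ≤ 2: known in print (curves; CJS surfaces)
    exact hlow p hp k X f hsep hft hqc hred hreg N hdim (Or.inl h2)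
  · -- dimension exactly 3: isolated (Cossart–Piltant) or corridor (open)
    by_cases hdisj : Disjoint
        (closure ({x : X | IsRegularLocalRing (X.presheaf.stalk x)}ᶜ \
          {x | Maximal (· ∈ Set.range (fun y : X =>
            Literature.RingTheory.HilbertSamuel.hilbertSamuelFun (X.presheaf.stalk y)
              (N - Literature.RingTheory.HilbertSamuel.minimalPrimesCodim (X.presheaf.stalk y))))
            (Literature.RingTheory.HilbertSamuel.hilbertSamuelFun (X.presheaf.stalk x)
              (N - Literature.RingTheory.HilbertSamuel.minimalPrimesCodim (X.presheaf.stalk x)))}))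
        {x | Maximal (· ∈ Set.range (fun y : X =>
            Literature.RingTheory.HilbertSamuel.hilbertSamuelFun (X.presheaf.stalk y)
              (N - Literature.RingTheory.HilbertSamuel.minimalPrimesCodim (X.presheaf.stalk y))))
            (Literature.RingTheory.HilbertSamuel.hilbertSamuelFun (X.presheaf.stalk x)
              (N - Literature.RingTheory.HilbertSamuel.minimalPrimesCodim (X.presheaf.stalk x)))}
    · exact hlow p hp k X f hsep hft hqc hred hreg N hdim (Or.inr ⟨h3', hdisj⟩)
    · exact hcor p hp k X f hsep hft hqc hred hreg h3 h3' N hdim hdisj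
  · -- dimension ≥ 4: open
    exact h4 p hp k X f hsep hft hqc hred hreg h4' N hdim

end Summit.ResolutionOfSingularities.ResolutionOfSingularities.Theorems.SigmaMaxModifications.Split

end
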